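import Literature.RingTheory.CohomologyAnnihilator.Basic
import Literature.RingTheory.CohomologyAnnihilator.TowerBasic
import Literature.RingTheory.CohomologyAnnihilator.NoetherDifferentAnnihilator
import Mathlib.Algebra.Homology.DerivedCategory.Ext.ExactSequences
import Mathlib.Algebra.Homology.DerivedCategory.Ext.Linear
import HarnessLib

/-!
# Lowering the level of a cohomology annihilator by an annihilator of `Ext^{>d}(–, R)` (Kimura)

Topic: `Literature/RingTheory/CohomologyAnnihilator`.

Let `R` be a commutative noetherian ring and `caⁿ(R) = ann_R Ext^{≥ n}_R(mod R, mod R)` the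
cohomology annihilator ideals of Iyengar–Takahashi (`cohomologyAnnihilatorOfDegree`,
[IyengarTakahashi2014, Def. 2.1]). In the proof of [Kimura2024StabilityCA, Thm. 2.5] K. Kimura
observes the following LOWERING STEP: if `t ∈ R` kills `Extʲ_R(M, R)` for all finitely generated
`M` and all `j ≥ d + 1` (the ideal `I = ⋂_M ann Ext^{d+1}_R(M, R)`, whose closed set is the
non-Gorenstein locus when `R` has a dualizing complex, [Kimura2024StabilityCA, Cor. 2.4]; for a
Cohen–Macaulay local ring with canonical module `ω` it is the stable annihilator
`ann Ext¹(ω, Ω ω)` of `ω`), then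

  `I · caⁱ⁺¹(R) ⊆ caⁱ(R)` for every `i ≥ d + 1`

("This means that `I · ca^{i+1}(R) ⊂ ca^i(R)` for every `i > d`", loc. cit.): for finitely
generated `M`, `N` present `0 → Ω N → R^m → N → 0`; in the exact
`Extⁱ(M, R^m) → Extⁱ(M, N) → Extⁱ⁺¹(M, Ω N)` an element `y ∈ caⁱ⁺¹(R)` pushes `Extⁱ(M, N)` into
the image of `Extⁱ(M, R^m)`, which `t` kills. Consequently `Iᵏ · caⁱ⁺ᵏ(R) ⊆ caⁱ(R)`, and if
`Ext^{>d}_R(mod R, R) = 0` (e.g. `R` Gorenstein of dimension `d`) then `ca(R) = caᵈ⁺¹(R)`.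

## Results

* `mul_smul_ext_eq_zero_of_shortExact_covariant` — covariant dimension shifting for annihilators
  along a short exact sequence `0 → X₁ → X₂ → X₃ → 0` in the SECOND variable: if `t` kills
  `Extⁱ(X, X₂)` and `y` kills `Extⁱ⁺¹(X, X₁)` then `t * y` kills `Extⁱ(X, X₃)` (any abelian
  `R`-linear category).
* `smul_ext_eq_zero_of_sum_comp_eq_id_right` — additivity in the second variable: if
  `𝟙_Z = Σⱼ πⱼ ≫ ιⱼ` factors through `G` and `t` kills `Extⁿ(X, G)` then `t` kills `Extⁿ(X, Z)`.
* `smul_ext_projective_eq_zero_of_forall_smul_ext_self` — if `t` kills `Extʲ(M, R)` for all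
  finitely generated `M` and `j ≥ d + 1`, then `t` kills `Extʲ(M, P)` for every finitely
  generated projective `P` (a summand of some `Rʳ`).
* **`mul_mem_cohomologyAnnihilatorOfDegree_of_forall_smul_ext_self`** — Kimura's lowering step:
  `t · caⁿ⁺¹(R) ⊆ caⁿ(R)` for `n ≥ d + 1`, and its iterate
  `pow_mul_mem_cohomologyAnnihilatorOfDegree_of_forall_smul_ext_self` (`tᵏ · caⁿ⁺ᵏ(R) ⊆ caⁿ(R)`).
* `pow_mul_mem_cohomologyAnnihilatorOfDegree_of_mem_cohomologyAnnihilator` — for `y ∈ ca(R)` some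
  power `tᵏ` has `tᵏ y ∈ caᵈ⁺¹(R)`.
* `forall_smul_ext_succ_eq_zero_right`, `forall_smul_ext_self_eq_zero_of_degree`,
  `mul_mem_cohomologyAnnihilatorOfDegree_of_forall_smul_ext_self_degree`,
  `pow_mul_mem_cohomologyAnnihilatorOfDegree_of_forall_smul_ext_self_degree` — the same with the hypothesis
  in the SINGLE degree `d + 1` (Kimura's `I = ⋂_M ann Ext^{d+1}_R(M, R)` literally; dimension shifting in
  the first variable with the second argument fixed).
* `cohomologyAnnihilatorOfDegree_eq_of_forall_ext_self_eq_zero`,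
  `cohomologyAnnihilator_eq_of_forall_ext_self_eq_zero` — if `Extʲ_R(M, R) = 0` for all finitely
  generated `M` and `j ≥ d + 1` then `caⁿ(R) = caᵈ⁺¹(R)` for `n ≥ d + 1` and `ca(R) = caᵈ⁺¹(R)`
  ([Kimura2024StabilityCA, Thm. 2.5] in the Gorenstein case, where it is an equality of ideals and
  not only of radicals).

Not here: dualizing complexes, the identification of `I` with the non-Gorenstein locus
([Kimura2024StabilityCA, Prop. 2.3 / Cor. 2.4]) or with the trace / stable annihilator of a
canonical module, and the radical statement `√ca(R) = √caᵈ⁺¹(R)` of [Kimura2024StabilityCA,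
Thm. 2.5] for general `R` (which needs `V(I) ⊆ Sing R`).

## References
* K. Kimura, *Stability of annihilators of cohomology and closed subsets defined by Jacobian
  ideals*, arXiv:2409.17934 (2024), proof of Theorem 2.5. [`Kimura2024StabilityCA`]
* S. B. Iyengar, R. Takahashi, *Annihilation of cohomology and strong generation of module
  categories*, IMRN 2016, Def. 2.1. [`IyengarTakahashi2014`]
-/

noncomputable section

open CategoryTheory CategoryTheory.Abelian CategoryTheory.Limits

universe w t v u

namespace Literature.RingTheory.CohomologyAnnihilator

/-! ## Covariant dimension shifting and additivity in the second variable -/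

section Linear

variable {R : Type t} [Ring R] {C : Type u} [Category.{v} C] [Abelian C] [Linear R C]
  [HasExt.{w} C]

/-- **Covariant dimension shifting for annihilators.** Let `0 → X₁ → X₂ → X₃ → 0` be short
exact. If `t` kills `Extⁱ(X, X₂)` and `y` kills `Extⁱ⁺¹(X, X₁)`, then `t * y` kills
`Extⁱ(X, X₃)`: in the exact `Extⁱ(X, X₂) → Extⁱ(X, X₃) —δ→ Extⁱ⁺¹(X, X₁)` one has
`δ (y • e) = y • δ e = 0`, so `y • e` comes from `Extⁱ(X, X₂)`, which `t` kills (the exact-sequence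
step of Kimura's argument). [cite: Kimura2024StabilityCA, Theorem 2.5 (proof)] -/
theorem mul_smul_ext_eq_zero_of_shortExact_covariant {S : ShortComplex C} (hS : S.ShortExact)
    {X : C} {i : ℕ} {t y : R} (ht : ∀ e : Ext X S.X₂ i, t • e = 0)
    (hy : ∀ e : Ext X S.X₁ (i + 1), y • e = 0) (e : Ext X S.X₃ i) : (t * y) • e = 0 := by
  have hδ : (y • e).comp hS.extClass (rfl : i + 1 = i + 1) = 0 := by
    rw [Ext.smul_comp]
    exact hy _
  obtain ⟨x₂, hx₂⟩ := Ext.covariant_sequence_exact₃ X hS (y • e) rfl hδ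
  rw [mul_smul, ← hx₂, ← Ext.smul_comp, ht, Ext.zero_comp]

/-- **Additivity of annihilation in the second variable.** If `𝟙_Z = Σⱼ πⱼ ≫ ιⱼ` with
`πⱼ : Z ⟶ G`, `ιⱼ : G ⟶ Z` (finitely many terms) and `t` kills `Extⁿ(X, G)`, then `t` kills
`Extⁿ(X, Z)`: `e = Σⱼ (e ∘ πⱼ) ∘ ιⱼ` and each `t • (e ∘ πⱼ) = 0` (additivity of `Ext` in the second
variable, the step `Extⁱ(M, R^⊕m) = Extⁱ(M, R)^⊕m` of Kimura's argument).
[cite: Kimura2024StabilityCA, Theorem 2.5 (proof)] -/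
theorem smul_ext_eq_zero_of_sum_comp_eq_id_right {X Z G : C} {ι : Type} [Fintype ι]
    (π : ι → (Z ⟶ G)) (ι' : ι → (G ⟶ Z)) (h : ∑ j, π j ≫ ι' j = 𝟙 Z) {n : ℕ} (t : R)
    (hG : ∀ e : Ext X G n, t • e = 0) (e : Ext X Z n) : t • e = 0 := by
  have he : e = ∑ j, (e.comp (Ext.mk₀ (π j)) (add_zero n)).comp (Ext.mk₀ (ι' j)) (add_zero n) := by
    simp only [Ext.comp_assoc_of_second_deg_zero, Ext.mk₀_comp_mk₀]
    rw [← Ext.comp_sum, ← Ext.mk₀_sum, h, Ext.comp_mk₀_id]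
  rw [he, Finset.smul_sum]
  refine Finset.sum_eq_zero fun j _ => ?_
  rw [← Ext.smul_comp, hG, Ext.zero_comp]

end Linear

/-! ## Kimura's lowering step over a commutative noetherian ring -/

section CommRing

variable {R : Type u} [CommRing R]

/-- If `t` kills `Extʲ_R(M, R)` for every finitely generated `M` and every `j ≥ d + 1`, then `t`
kills `Extʲ_R(M, P)` for every finitely generated projective `P` (a direct summand of some `Rʳ`:
`𝟙_P = Σⱼ αⱼ ≫ βⱼ` through `R`). [cite: Kimura2024StabilityCA, Theorem 2.5 (proof)] -/
theorem smul_ext_projective_eq_zero_of_forall_smul_ext_self {t : R} {d : ℕ}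
    (ht : ∀ (M : ModuleCat.{u} R), Module.Finite R M → ∀ j : ℕ, d + 1 ≤ j →
      ∀ e : Ext.{u} M (ModuleCat.of R R) j, t • e = 0)
    (P : ModuleCat.{u} R) [Module.Finite R P] [Module.Projective R P]
    (M : ModuleCat.{u} R) [Module.Finite R M] {j : ℕ} (hj : d + 1 ≤ j) (e : Ext.{u} M P j) :
    t • e = 0 := by
  obtain ⟨r, α, β, h⟩ := exists_sum_comp_eq_id_of_projective (B := R) P
  exact smul_ext_eq_zero_of_sum_comp_eq_id_right α β h t (ht M ‹_› j hj) e

/-- **Kimura's lowering step: `t · caⁿ⁺¹(R) ⊆ caⁿ(R)` for `n ≥ d + 1`.** Let `R` be noetherian,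
`t ∈ R` an element killing `Extʲ_R(M, R)` for all finitely generated `M` and all `j ≥ d + 1`, and
`y ∈ caⁿ⁺¹(R)` with `n ≥ d + 1`. Then `t y ∈ caⁿ(R)`: in degrees `≥ n + 1` already `y` kills; in
degree `n`, present `0 → K → Rᵐ → N → 0` and use the exact
`Extⁿ(M, Rᵐ) → Extⁿ(M, N) → Extⁿ⁺¹(M, K)` — `y` kills the right-hand term (`K` is finitely
generated), `t` the left-hand one. [cite: Kimura2024StabilityCA, Theorem 2.5 (proof)] -/
theorem mul_mem_cohomologyAnnihilatorOfDegree_of_forall_smul_ext_self [IsNoetherianRing R]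
    {t y : R} {d n : ℕ} (hn : d + 1 ≤ n)
    (ht : ∀ (M : ModuleCat.{u} R), Module.Finite R M → ∀ j : ℕ, d + 1 ≤ j →
      ∀ e : Ext.{u} M (ModuleCat.of R R) j, t • e = 0)
    (hy : y ∈ cohomologyAnnihilatorOfDegree R (n + 1)) :
    t * y ∈ cohomologyAnnihilatorOfDegree R n := by
  rw [mem_cohomologyAnnihilatorOfDegree_iff]
  intro i hi M N hM hN e
  by_cases hi' : n + 1 ≤ i
  · rw [mul_smul, smul_eq_zero_of_mem_cohomologyAnnihilatorOfDegree hy hi' e, smul_zero]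
  · have hin : i = n := by omega
    subst hin
    -- present `N` as a quotient of a finite free module
    obtain ⟨m, q, hq⟩ := Module.Finite.exists_fin' R N
    set K := LinearMap.ker q with hK
    obtain ⟨w, hS⟩ := exists_shortExact_of_linearMap (Y := ModuleCat.of R K)
      (M := ModuleCat.of R (Fin m → R)) (X := N) K.subtype q Subtype.val_injective hq
      (LinearMap.exact_subtype_ker_map q)
    haveI : Module.Finite R K := Module.IsNoetherian.finite R _
    refine mul_smul_ext_eq_zero_of_shortExact_covariant hS (X := M) (t := t) (y := y)
      (fun e' => ?_) (fun e' => ?_) e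
    · exact smul_ext_projective_eq_zero_of_forall_smul_ext_self ht
        (ModuleCat.of R (Fin m → R)) M hn e'
    · exact smul_eq_zero_of_mem_cohomologyAnnihilatorOfDegree hy (by omega) e'

/-- **Iterated lowering: `tᵏ · caⁿ⁺ᵏ(R) ⊆ caⁿ(R)` for `n ≥ d + 1`.**
[cite: Kimura2024StabilityCA, Theorem 2.5 (proof)] -/
theorem pow_mul_mem_cohomologyAnnihilatorOfDegree_of_forall_smul_ext_self [IsNoetherianRing R]
    {t : R} {d n : ℕ} (hn : d + 1 ≤ n)
    (ht : ∀ (M : ModuleCat.{u} R), Module.Finite R M → ∀ j : ℕ, d + 1 ≤ j →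
      ∀ e : Ext.{u} M (ModuleCat.of R R) j, t • e = 0) :
    ∀ (k : ℕ) {y : R}, y ∈ cohomologyAnnihilatorOfDegree R (n + k) →
      t ^ k * y ∈ cohomologyAnnihilatorOfDegree R n := by
  intro k
  induction k generalizing n with
  | zero =>
    intro y hy
    simpa using hy
  | succ k ih =>
    intro y hy
    have hy' : y ∈ cohomologyAnnihilatorOfDegree R ((n + 1) + k) := by
      rw [show (n + 1) + k = n + (k + 1) by omega]
      exact hy
    have h1 : t ^ k * y ∈ cohomologyAnnihilatorOfDegree R (n + 1) := ih (by omega) hy'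
    have h2 := mul_mem_cohomologyAnnihilatorOfDegree_of_forall_smul_ext_self hn ht h1
    simpa [pow_succ, mul_comm, mul_assoc, mul_left_comm] using h2

/-- **Every element of `ca(R)` is lowered to level `d + 1` by a power of `t`**: for `y ∈ ca(R)`
there is `k` with `tᵏ y ∈ caᵈ⁺¹(R)` (`ca(R) = caᴺ(R)` for some `N`, noetherianity of the tower).
[cite: Kimura2024StabilityCA, Theorem 2.5 (proof)] -/
theorem pow_mul_mem_cohomologyAnnihilatorOfDegree_of_mem_cohomologyAnnihilator
    [IsNoetherianRing R] {t : R} {d : ℕ}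
    (ht : ∀ (M : ModuleCat.{u} R), Module.Finite R M → ∀ j : ℕ, d + 1 ≤ j →
      ∀ e : Ext.{u} M (ModuleCat.of R R) j, t • e = 0)
    {y : R} (hy : y ∈ cohomologyAnnihilator R) :
    ∃ k : ℕ, t ^ k * y ∈ cohomologyAnnihilatorOfDegree R (d + 1) := by
  obtain ⟨N, hN⟩ := mem_cohomologyAnnihilator_iff.mp hy
  refine ⟨N, pow_mul_mem_cohomologyAnnihilatorOfDegree_of_forall_smul_ext_self le_rfl ht N ?_⟩
  exact cohomologyAnnihilatorOfDegree_mono (by omega) hN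

/-- **No lowering obstruction when `Ext^{>d}_R(mod R, R) = 0`**: if `Extʲ_R(M, R) = 0` for all
finitely generated `M` and all `j ≥ d + 1` (e.g. `R` Gorenstein of dimension `≤ d`), then
`caⁿ(R) = caᵈ⁺¹(R)` for every `n ≥ d + 1` (take `t = 1`).
[cite: Kimura2024StabilityCA, Theorem 2.5] -/
theorem cohomologyAnnihilatorOfDegree_eq_of_forall_ext_self_eq_zero [IsNoetherianRing R] {d : ℕ}
    (h : ∀ (M : ModuleCat.{u} R), Module.Finite R M → ∀ j : ℕ, d + 1 ≤ j →
      ∀ e : Ext.{u} M (ModuleCat.of R R) j, e = 0)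
    {n : ℕ} (hn : d + 1 ≤ n) :
    cohomologyAnnihilatorOfDegree R n = cohomologyAnnihilatorOfDegree R (d + 1) := by
  have ht : ∀ (M : ModuleCat.{u} R), Module.Finite R M → ∀ j : ℕ, d + 1 ≤ j →
      ∀ e : Ext.{u} M (ModuleCat.of R R) j, (1 : R) • e = 0 := fun M hM j hj e => by
    rw [h M hM j hj e, smul_zero]
  refine le_antisymm ?_ (cohomologyAnnihilatorOfDegree_mono hn)
  obtain ⟨k, rfl⟩ := Nat.exists_eq_add_of_le hn
  intro y hy
  have := pow_mul_mem_cohomologyAnnihilatorOfDegree_of_forall_smul_ext_self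
    (le_refl (d + 1)) ht k hy
  simpa using this

/-- **`ca(R) = caᵈ⁺¹(R)` when `Ext^{>d}_R(mod R, R) = 0`** — an equality of ideals (for general
`R` only the radicals agree, [Kimura2024StabilityCA, Thm. 2.5]).
[cite: Kimura2024StabilityCA, Theorem 2.5] -/
theorem cohomologyAnnihilator_eq_of_forall_ext_self_eq_zero [IsNoetherianRing R] {d : ℕ}
    (h : ∀ (M : ModuleCat.{u} R), Module.Finite R M → ∀ j : ℕ, d + 1 ≤ j →
      ∀ e : Ext.{u} M (ModuleCat.of R R) j, e = 0) :
    cohomologyAnnihilator R = cohomologyAnnihilatorOfDegree R (d + 1) := by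
  refine le_antisymm ?_ (cohomologyAnnihilatorOfDegree_le (d + 1))
  refine iSup_le fun n => ?_
  by_cases hn : d + 1 ≤ n
  · exact (cohomologyAnnihilatorOfDegree_eq_of_forall_ext_self_eq_zero h hn).le
  · exact cohomologyAnnihilatorOfDegree_mono (by omega)


/-! ## The hypothesis in the single degree `d + 1` (Kimura's ideal `I = ⋂_M ann Ext^{d+1}_R(M, R)`) -/

/-- **Dimension shifting in the first variable with a FIXED second argument**: over a noetherian ring,
if `t` kills `Extⁿ_R(M, N)` for every finitely generated `M` (the module `N` being fixed), then `t` kills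
`Extⁿ⁺¹_R(M, N)` for every finitely generated `M` — `Extⁿ(Ω M, N) ↠ Extⁿ⁺¹(M, N)` along a finite free
presentation `0 → Ω M → P → M → 0` (the argument of [IyengarTakahashi2014, Remark 2.3], which never moves
the second variable). [cite: IyengarTakahashi2014, Remark 2.3] -/
theorem forall_smul_ext_succ_eq_zero_right [IsNoetherianRing R] {n : ℕ} {t : R} (N : ModuleCat.{u} R)
    (h : ∀ (M : ModuleCat.{u} R), Module.Finite R M → ∀ e : Ext.{u} M N n, t • e = 0)
    (M : ModuleCat.{u} R) [Module.Finite R M] (e : Ext.{u} M N (n + 1)) : t • e = 0 := by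
  obtain ⟨P, _, _, _, _, f, surjf⟩ := Module.exists_finite_presentation R M
  have hS := LinearMap.shortExact_shortComplexKer surjf
  obtain ⟨e', rfl⟩ := precomp_extClass_surjective_of_projective_X₂ N hS n e
  have : Module.Finite R (LinearMap.ker f) := Module.IsNoetherian.finite R _
  have h' := h (ModuleCat.of R (LinearMap.ker f)) inferInstance e'
  change t • (hS.extClass.precompOfLinear R N (add_comm 1 n)) e' = 0
  rw [← LinearMap.map_smul, h', LinearMap.map_zero]

/-- **Kimura's ideal needs only the degree `d + 1`**: if `t` kills `Extᵈ⁺¹_R(M, R)` for every finitely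
generated `M` (i.e. `t ∈ I = ⋂_M ann Ext^{d+1}_R(M, R)`, [Kimura2024StabilityCA, proof of Thm. 2.5]), then `t`
kills `Extʲ_R(M, R)` for every finitely generated `M` and every `j ≥ d + 1`.
[cite: Kimura2024StabilityCA, Theorem 2.5 (proof)] -/
theorem forall_smul_ext_self_eq_zero_of_degree [IsNoetherianRing R] {t : R} {d : ℕ}
    (ht : ∀ (M : ModuleCat.{u} R), Module.Finite R M →
      ∀ e : Ext.{u} M (ModuleCat.of R R) (d + 1), t • e = 0) :
    ∀ (M : ModuleCat.{u} R), Module.Finite R M → ∀ j : ℕ, d + 1 ≤ j →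
      ∀ e : Ext.{u} M (ModuleCat.of R R) j, t • e = 0 := by
  intro M hM j hj
  obtain ⟨k, rfl⟩ := Nat.exists_eq_add_of_le hj
  clear hj
  induction k generalizing M with
  | zero => simpa using ht M hM
  | succ k ih =>
    intro e
    haveI := hM
    exact forall_smul_ext_succ_eq_zero_right (n := d + 1 + k) (ModuleCat.of R R)
      (fun M' hM' e' => ih M' hM' e') M e

/-- **Kimura's lowering step, literal form: `I · caⁿ⁺¹(R) ⊆ caⁿ(R)` for `n ≥ d + 1`, `I = ⋂_M ann Ext^{d+1}_R(M, R)`.**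
For `R` noetherian, `t` killing `Extᵈ⁺¹_R(M, R)` for all finitely generated `M`, and `y ∈ caⁿ⁺¹(R)` with
`n ≥ d + 1`: `t y ∈ caⁿ(R)`. [cite: Kimura2024StabilityCA, Theorem 2.5 (proof)] -/
theorem mul_mem_cohomologyAnnihilatorOfDegree_of_forall_smul_ext_self_degree [IsNoetherianRing R]
    {t y : R} {d n : ℕ} (hn : d + 1 ≤ n)
    (ht : ∀ (M : ModuleCat.{u} R), Module.Finite R M →
      ∀ e : Ext.{u} M (ModuleCat.of R R) (d + 1), t • e = 0)
    (hy : y ∈ cohomologyAnnihilatorOfDegree R (n + 1)) :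
    t * y ∈ cohomologyAnnihilatorOfDegree R n :=
  mul_mem_cohomologyAnnihilatorOfDegree_of_forall_smul_ext_self hn
    (forall_smul_ext_self_eq_zero_of_degree ht) hy

/-- **Iterated literal form: `Iᵏ · caⁿ⁺ᵏ(R) ⊆ caⁿ(R)`** (one generator `t ∈ I` at a time: `tᵏ y ∈ caⁿ(R)` for
`y ∈ caⁿ⁺ᵏ(R)`, `n ≥ d + 1`). [cite: Kimura2024StabilityCA, Theorem 2.5 (proof)] -/
theorem pow_mul_mem_cohomologyAnnihilatorOfDegree_of_forall_smul_ext_self_degree [IsNoetherianRing R]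
    {t : R} {d n : ℕ} (hn : d + 1 ≤ n)
    (ht : ∀ (M : ModuleCat.{u} R), Module.Finite R M →
      ∀ e : Ext.{u} M (ModuleCat.of R R) (d + 1), t • e = 0)
    (k : ℕ) {y : R} (hy : y ∈ cohomologyAnnihilatorOfDegree R (n + k)) :
    t ^ k * y ∈ cohomologyAnnihilatorOfDegree R n :=
  pow_mul_mem_cohomologyAnnihilatorOfDegree_of_forall_smul_ext_self hn
    (forall_smul_ext_self_eq_zero_of_degree ht) k hy

end CommRing

end Literature.RingTheory.CohomologyAnnihilator

end
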